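import Summits.QuantumFields.YangMills.Theorems.UnitScaleTiltProp7RelPlaqVsCovCurl
import HarnessLib

/-!
# Route `UnitScaleTilt`, crux K1 child «MinimiserStabilityRegPr» (stmt-QuantumFields-19200), route-R GROWTH (MAP #3 M10, S3 «nonlinear passage») —
# THE PASSAGE WITH THE DIVERGENCE DISPLAYED AS A BUDGET, part 1∕3: S2′ and the (ii′)-shape WITHOUT `hdiv`

Cell `ym3-torus`, keyed width hand `ym-routeR-w3` (D-0154 (3c); MAP #3 row M10; LOCATED 2026-08-28 05:10Z on the cell bus).  THEOREMS ONLY (0 `def`, 0 `sorry`);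
`--supports stmt-QuantumFields-19200`, count-neutral.  YM₃ on T³ is a ladder rung (R3), not the Clay problem; nothing here claims the stub, the crux, d = 4 or the mass gap.

WHY (numbers).  S2′ (`Prop7CurvedLandauCoercivity.sum_normSq_le_curl_sq_of_landau_of_structure_T3`, ✓ p601741) and brick (c) §3
(`Prop7RelPlaqVsCovCurl.relPoincare_of_landau_of_structure_T3`, ✓ p605008) assume the EXACT covariant Landau slice `hdiv : D^*_{U₀}Y = 0`.  A nonlinear pair never meets it:
for an `ℓ²`-optimal representative the first-order condition is only the `𝔰𝔲(2)`-projection of `D^*_{U₀}Y`, and brick (a) (`Prop7PointLandauDivergence.divB_optimalRepr_eq`,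
✓ p605285) shows `D^*_{U₀}Y` is then EXACTLY quadratic (off the centres for the pinned optimum, at every site for the unpinned one — parts 2∕3 and 3∕3,
`…Prop7PointLandauBudget`, `…Prop7RelPoincareOptRepr`).  The engine `Prop7CovariantCoercivity.sum_normSq_le_curl_sq_add_divB_sq_add_avg_T3` carries the divergence as
`18·Σ_x‖(D^*_{U₀}Y)(x)‖²_HS` on the right; so the passage needs S2′ with the divergence DISPLAYED AS A BUDGET `Σ_x‖D^*Y(x)‖²_HS ≤ δ·Σ_b‖Y_b‖² + Z` (`δ` the absorbable
part — the stationary sites cost `δ = 2d·s² = 6s²`, `18δ = 108s²`, negligible next to (c)'s `442368s²` and k-uniform at `s = ε₂L^{−(K−n)}` — and `Z` an explicit debit, e.g.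
the centre divergence energy of the pinned optimum, which is NOT absorbable in general: a charge mode `q∇G` at a centre has `‖D^*Y‖² ≈ q²` there against a gain
`L^{−2(K−n)}·0.2527q²`; that is the pinned ↔ Landau fork S2″ of ★p1's RULING (P)∕(Λ) in passage currency, decided elsewhere).  The `Q^{(k)}`-defect (brick (b)) is NOT here
either: in S2′'s letters it rides as an extra `E`-term (`c_E` free) or Λ-term (`G`, `c_Λ` free).

WHAT IS PROVED (ns `…Theorems.Prop7RelPoincareDivBudget`).
* §1 ★ `sum_normSq_le_curl_sq_of_divBudget_of_structure_T3` — S2′ verbatim with `hdiv` replaced by the budget `hdivB`: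
  `((1 − 32c_Eε²)·L^{−2(K−n)} − 18δ)·Σ_b‖Y_b‖² − 18Z ≤ 18·Σ‖D_{U₀}Y‖²_HS + 384c_Λ·G`.
* §2 ★ `relPoincare_of_divBudget_of_structure_T3` — (c) §3 verbatim with `hdiv` replaced by `hdivB`:
  `((1 − 32c_Eε²)·L^{−2(K−n)} − 18δ − 442368s² − 13824ε²L^{−4(K−n)})·Σ_b‖Y_b‖² − 18Z ≤ 72·Σ_p‖R_p − 1‖² + 384c_Λ·G`.

HONEST SCOPE.  Bookkeeping over p1's engine, S2′ and brick (c); the structure rows (curved N6: Λ, E, G, c_Λ, c_E), the sup radius `s` and the budget stay DISPLAYED; nothing of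
[Balaban1985Variational] ∕ [Balaban1985BackgroundPropagators] is asserted.

References: T. Bałaban, CMP 99 (1985) 389–434 [Balaban1985BackgroundPropagators] ((3.8) p.392, Thm 3.11 p.416); CMP 102 (1985) 277–309 [Balaban1985Variational] ((4) p.278,
(14) p.280, (22)–(28) pp.281–282, (141)–(143) p.299); CMP 99 (1985) 75–102 [Balaban1985RegularSpaces] ((1.38) p.82).
-/

set_option autoImplicit false

noncomputable section

open scoped BigOperators Matrix.Norms.L2Operator Matrix

namespace Summit.QuantumFields.YangMills.Theorems.Prop7RelPoincareDivBudget

open Literature.MathematicalPhysics.QuantumFieldTheory.Balaban1983to89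
open Literature.MathematicalPhysics.QuantumFieldTheory.Balaban1983to89.T3ContinuumYM3Torus
open Finset B1RG242Torus
open B7Prop1Explicit (treeWord)
open B7Eq78Linearization (conjR)
open B9Eq39Adjoint (curl divB)
open B10Eq27TorusAxialLog (holT unitsField toUField)
open B9TorusCalculus (torusT)
open Summit.QuantumFields.YangMills.Theorems.Prop7CovariantCoercivity (sum_normSq_le_curl_sq_add_divB_sq_add_avg_T3)
open Summit.QuantumFields.YangMills.Theorems.Prop7CurvedLandauCoercivity (sum_sq_norm_add_le)
open Summit.QuantumFields.YangMills.Theorems.Prop7RelPlaqVsCovCurl (sum_hs_curl_le_relPlaq_T3)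

/-! ## §1 ★ S2′ with the divergence displayed as a budget -/

/-- ★ **S2′ WITH A DIVERGENCE BUDGET** — `Prop7CurvedLandauCoercivity.sum_normSq_le_curl_sq_of_landau_of_structure_T3` VERBATIM except that the exact Landau hypothesis
`hdiv : D^*_{U₀}Y = 0` is replaced by the budget `Σ_xΣ_jk|(D^*_{U₀}Y)(x)_jk|² ≤ δ·Σ_b‖Y(b)‖² + Z`: background `U₀ ∈ SU(2)` with `dist1(U₀(∂p)) ≤ εL^{−2(K−n)}`, `216ε ≤ 1`, structure
rows (Λ, E, G, c_Λ, c_E) displayed; THEN `((1 − 32c_Eε²)·L^{−2(K−n)} − 18δ)·Σ_b‖Y(b)‖² − 18Z ≤ 18·Σ_{x,μ<ν}‖(D_{U₀}Y)(p_{μν}(x))‖²_HS + 384·c_Λ·G`.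
[cite: Balaban1985BackgroundPropagators, Thm 3.11 p.416] -/
theorem sum_normSq_le_curl_sq_of_divBudget_of_structure_T3 (F : T3Family) (n K : ℕ)
    (U₀ : GaugeField (F.P K) 0 (Matrix.specialUnitaryGroup (Fin 2) ℂ)) {ε : ℝ} (hε : 0 ≤ ε) (hε1 : 216 * ε ≤ 1)
    (hU : ∀ p : Plaq (F.P K) 0, dist1 (GaugeField.plaqHol U₀ p) ≤ ε * (((F.L : ℝ) ^ (K - n)) ^ 2)⁻¹)
    (Y : PBond (F.P K) 0 → Matrix (Fin 2) (Fin 2) ℂ) {δ Z : ℝ}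
    (hdivB : ∑ x : Site (F.P K) 0, ∑ j : Fin 2, ∑ k : Fin 2,
        ‖(divB (torusT (F.P K) 0) (fun κ z => unitsField (toUField U₀) ⟨z, κ⟩) (fun κ z => Y ⟨z, κ⟩) x) j k‖ ^ 2
      ≤ δ * ∑ b : PBond (F.P K) 0, ‖Y b‖ ^ 2 + Z)
    (Λ : Site (F.P K) (K - n) → Matrix (Fin 2) (Fin 2) ℂ) (E : PBond (F.P K) (K - n) → ℝ) {G cΛ cE : ℝ}
    (hA : ∀ c : PBond (F.P K) (K - n),
      ‖∑ r : Fin (F.P K).d → Fin ((F.P K).L ^ (K - n)), ∑ t ∈ range ((F.P K).L ^ (K - n)),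
        conjR (holT (unitsField (toUField U₀)) (Site.fibreSite 0 (K - n) c.src fun _ => ⟨0, pow_pos (F.P K).L_pos (K - n)⟩)
              (treeWord fun ν => ((r ν : ℕ) : ℤ))
            * holT (unitsField (toUField U₀)) (Site.fibreSite 0 (K - n) c.src r) (List.replicate t (c.dir, true)))
          (Y ⟨(fun z : Site (F.P K) 0 => z.shift c.dir)^[t] (Site.fibreSite 0 (K - n) c.src r), c.dir⟩)‖
        ≤ ((F.L : ℝ) ^ (K - n)) ^ 3 * (‖Λ c.tgt‖ + ‖Λ c.src‖) + E c)
    (hΛ : ∑ y : Site (F.P K) (K - n), ‖Λ y‖ ^ 2 ≤ cΛ * (F.L : ℝ) ^ (K - n) * G)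
    (hE : ∑ c : PBond (F.P K) (K - n), E c ^ 2 ≤ cE * ((F.L : ℝ) ^ (K - n)) ^ 5 * ε ^ 2 * ∑ b : PBond (F.P K) 0, ‖Y b‖ ^ 2) :
    ((1 - 32 * cE * ε ^ 2) * (((F.L : ℝ) ^ (K - n)) ^ 2)⁻¹ - 18 * δ) * ∑ b : PBond (F.P K) 0, ‖Y b‖ ^ 2 - 18 * Z
      ≤ 18 * ∑ x : Site (F.P K) 0, ∑ μ : Fin (F.P K).d, ∑ ν : Fin (F.P K).d,
            (if μ < ν then ∑ j : Fin 2, ∑ k : Fin 2,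
              ‖(curl (torusT (F.P K) 0) (fun κ z => unitsField (toUField U₀) ⟨z, κ⟩) (fun κ z => Y ⟨z, κ⟩) μ ν x) j k‖ ^ 2 else 0)
        + 384 * cΛ * G := by
  have hLpos : (0 : ℝ) < (F.L : ℝ) := by have := F.hL.2; exact_mod_cast (by omega : 0 < F.L)
  have hℓ : (0 : ℝ) < (F.L : ℝ) ^ (K - n) := pow_pos hLpos _
  have hd : (F.P K).d = 3 := T3Family.P_d F K
  -- the engine, with the divergence term KEPT
  have heng := sum_normSq_le_curl_sq_add_divB_sq_add_avg_T3 F n K U₀ hε hε1 hU Y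
  have hdpow : ((F.L : ℝ) ^ (K - n)) ^ (F.P K).d = ((F.L : ℝ) ^ (K - n)) ^ 3 := by rw [hd]
  rw [hdpow] at heng
  -- the penalty through the displayed rows (S2′ §1)
  have hAVG : ∑ c : PBond (F.P K) (K - n),
      ‖∑ r : Fin (F.P K).d → Fin ((F.P K).L ^ (K - n)), ∑ t ∈ range ((F.P K).L ^ (K - n)),
        conjR (holT (unitsField (toUField U₀)) (Site.fibreSite 0 (K - n) c.src fun _ => ⟨0, pow_pos (F.P K).L_pos (K - n)⟩)
              (treeWord fun ν => ((r ν : ℕ) : ℤ))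
            * holT (unitsField (toUField U₀)) (Site.fibreSite 0 (K - n) c.src r) (List.replicate t (c.dir, true)))
          (Y ⟨(fun z : Site (F.P K) 0 => z.shift c.dir)^[t] (Site.fibreSite 0 (K - n) c.src r), c.dir⟩)‖ ^ 2
      ≤ 8 * (F.P K).d * (((F.L : ℝ) ^ (K - n)) ^ 3) ^ 2 * ∑ y : Site (F.P K) (K - n), ‖Λ y‖ ^ 2 + 2 * ∑ c : PBond (F.P K) (K - n), E c ^ 2 := by
    refine le_trans ?_ (sum_sq_norm_add_le (((F.L : ℝ) ^ (K - n)) ^ 3) Λ E)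
    refine Finset.sum_le_sum fun c _ => ?_
    have h0 := norm_nonneg (∑ r : Fin (F.P K).d → Fin ((F.P K).L ^ (K - n)), ∑ t ∈ range ((F.P K).L ^ (K - n)),
        conjR (holT (unitsField (toUField U₀)) (Site.fibreSite 0 (K - n) c.src fun _ => ⟨0, pow_pos (F.P K).L_pos (K - n)⟩)
              (treeWord fun ν => ((r ν : ℕ) : ℤ))
            * holT (unitsField (toUField U₀)) (Site.fibreSite 0 (K - n) c.src r) (List.replicate t (c.dir, true)))
          (Y ⟨(fun z : Site (F.P K) 0 => z.shift c.dir)^[t] (Site.fibreSite 0 (K - n) c.src r), c.dir⟩))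
    exact pow_le_pow_left₀ h0 (hA c) 2
  have hd3 : ((F.P K).d : ℝ) = 3 := by rw [hd]; norm_num
  rw [hd3] at hAVG
  -- scalars
  set ℓ : ℝ := (F.L : ℝ) ^ (K - n) with hℓdef
  set SY : ℝ := ∑ b : PBond (F.P K) 0, ‖Y b‖ ^ 2 with hSYdef
  have hSY : 0 ≤ SY := by positivity
  have hpen : 16 * (((ℓ ^ 3) * ℓ ^ 2)⁻¹ * (ℓ ^ 2)⁻¹) * (8 * 3 * (ℓ ^ 3) ^ 2 * ∑ y : Site (F.P K) (K - n), ‖Λ y‖ ^ 2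
        + 2 * ∑ c : PBond (F.P K) (K - n), E c ^ 2)
      ≤ 384 * cΛ * G + 32 * cE * ε ^ 2 * ((ℓ ^ 2)⁻¹ * SY) := by
    have h1 : 16 * (((ℓ ^ 3) * ℓ ^ 2)⁻¹ * (ℓ ^ 2)⁻¹) * (8 * 3 * (ℓ ^ 3) ^ 2 * ∑ y : Site (F.P K) (K - n), ‖Λ y‖ ^ 2)
        = 384 * ℓ⁻¹ * ∑ y : Site (F.P K) (K - n), ‖Λ y‖ ^ 2 := by
      field_simp
      ring
    have h2 : 16 * (((ℓ ^ 3) * ℓ ^ 2)⁻¹ * (ℓ ^ 2)⁻¹) * (2 * ∑ c : PBond (F.P K) (K - n), E c ^ 2)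
        = 32 * (ℓ ^ 7)⁻¹ * ∑ c : PBond (F.P K) (K - n), E c ^ 2 := by
      field_simp
      ring
    rw [mul_add, h1, h2]
    have h3 : 384 * ℓ⁻¹ * ∑ y : Site (F.P K) (K - n), ‖Λ y‖ ^ 2 ≤ 384 * cΛ * G := by
      calc 384 * ℓ⁻¹ * ∑ y : Site (F.P K) (K - n), ‖Λ y‖ ^ 2 ≤ 384 * ℓ⁻¹ * (cΛ * ℓ * G) :=
            mul_le_mul_of_nonneg_left hΛ (by positivity)
        _ = 384 * cΛ * G := by field_simp
    have h4 : 32 * (ℓ ^ 7)⁻¹ * ∑ c : PBond (F.P K) (K - n), E c ^ 2 ≤ 32 * cE * ε ^ 2 * ((ℓ ^ 2)⁻¹ * SY) := by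
      calc 32 * (ℓ ^ 7)⁻¹ * ∑ c : PBond (F.P K) (K - n), E c ^ 2 ≤ 32 * (ℓ ^ 7)⁻¹ * (cE * ℓ ^ 5 * ε ^ 2 * SY) :=
            mul_le_mul_of_nonneg_left hE (by positivity)
        _ = 32 * cE * ε ^ 2 * ((ℓ ^ 2)⁻¹ * SY) := by field_simp
    linarith
  have hK : (0 : ℝ) ≤ 16 * (((ℓ ^ 3) * ℓ ^ 2)⁻¹ * (ℓ ^ 2)⁻¹) := by positivity
  have hmain := heng.trans (add_le_add le_rfl (mul_le_mul_of_nonneg_left hAVG hK))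
  -- `hmain : (ℓ²)⁻¹ SY ≤ 18 (CURL + DIV) + 16 K · (24 ℓ⁶ ΣΛ² + 2ΣE²)`, `hdivB : DIV ≤ δ SY + Z`
  have e : ((1 - 32 * cE * ε ^ 2) * (ℓ ^ 2)⁻¹ - 18 * δ) * SY = (ℓ ^ 2)⁻¹ * SY - 32 * cE * ε ^ 2 * ((ℓ ^ 2)⁻¹ * SY) - 18 * (δ * SY) := by
    ring
  rw [e]
  linarith [hmain, hpen, hdivB]

/-! ## §2 ★ The (ii′)-currency twin: brick (c) with the divergence budget -/

/-- ★ **(ii′)-SHAPE MODULO THE STRUCTURE ROWS, WITH A DIVERGENCE BUDGET** — `Prop7RelPlaqVsCovCurl.relPoincare_of_landau_of_structure_T3` VERBATIM except `hdiv ↦ hdivB`: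
background `U₀` with plaquettes within `εL^{−2(K−n)}` (`216ε ≤ 1`), competitor `W`, `Y = WU₀^* − 1` with `‖Y(b)‖ ≤ s ≤ 1`, `Σ_x‖(D^*_{U₀}Y)(x)‖²_HS ≤ δ·Σ_b‖Y_b‖² + Z`, structure rows
(Λ, E, G, c_Λ, c_E) displayed at this `Y`; THEN `((1 − 32c_Eε²)·L^{−2(K−n)} − 18δ − 442368s² − 13824ε²L^{−4(K−n)})·Σ_b‖Y(b)‖² − 18Z ≤ 72·Σ_p‖R_p − 1‖² + 384c_Λ·G`,
`R_p = W(∂p)U₀(∂p)^*`. [cite: Balaban1985BackgroundPropagators, Thm 3.11 p.416; Balaban1985Variational, (141)-(143) p.299] -/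
theorem relPoincare_of_divBudget_of_structure_T3 (F : T3Family) (n K : ℕ)
    (W U₀ : GaugeField (F.P K) 0 (Matrix.specialUnitaryGroup (Fin 2) ℂ)) {ε s : ℝ} (hε : 0 ≤ ε) (hε1 : 216 * ε ≤ 1)
    (hU₀ : ∀ p : Plaq (F.P K) 0, dist1 (GaugeField.plaqHol U₀ p) ≤ ε * (((F.L : ℝ) ^ (K - n)) ^ 2)⁻¹)
    (hδ : ∀ b : PBond (F.P K) 0, ‖(W b : Matrix (Fin 2) (Fin 2) ℂ) * star (U₀ b : Matrix (Fin 2) (Fin 2) ℂ) - 1‖ ≤ s) (hs1 : s ≤ 1) {δ Z : ℝ}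
    (hdivB : ∑ x : Site (F.P K) 0, ∑ j : Fin 2, ∑ k : Fin 2,
        ‖(divB (torusT (F.P K) 0) (fun κ z => unitsField (toUField U₀) ⟨z, κ⟩)
          (fun κ z => (W ⟨z, κ⟩ : Matrix (Fin 2) (Fin 2) ℂ) * star (U₀ ⟨z, κ⟩ : Matrix (Fin 2) (Fin 2) ℂ) - 1) x) j k‖ ^ 2
      ≤ δ * ∑ b : PBond (F.P K) 0, ‖(W b : Matrix (Fin 2) (Fin 2) ℂ) * star (U₀ b : Matrix (Fin 2) (Fin 2) ℂ) - 1‖ ^ 2 + Z)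
    (Λ : Site (F.P K) (K - n) → Matrix (Fin 2) (Fin 2) ℂ) (E : PBond (F.P K) (K - n) → ℝ) {G cΛ cE : ℝ}
    (hA : ∀ c : PBond (F.P K) (K - n),
      ‖∑ r : Fin (F.P K).d → Fin ((F.P K).L ^ (K - n)), ∑ t ∈ range ((F.P K).L ^ (K - n)),
        conjR (holT (unitsField (toUField U₀)) (Site.fibreSite 0 (K - n) c.src fun _ => ⟨0, pow_pos (F.P K).L_pos (K - n)⟩)
              (treeWord fun ν => ((r ν : ℕ) : ℤ))
            * holT (unitsField (toUField U₀)) (Site.fibreSite 0 (K - n) c.src r) (List.replicate t (c.dir, true)))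
          ((W ⟨(fun z : Site (F.P K) 0 => z.shift c.dir)^[t] (Site.fibreSite 0 (K - n) c.src r), c.dir⟩ : Matrix (Fin 2) (Fin 2) ℂ)
              * star (U₀ ⟨(fun z : Site (F.P K) 0 => z.shift c.dir)^[t] (Site.fibreSite 0 (K - n) c.src r), c.dir⟩ : Matrix (Fin 2) (Fin 2) ℂ) - 1)‖
        ≤ ((F.L : ℝ) ^ (K - n)) ^ 3 * (‖Λ c.tgt‖ + ‖Λ c.src‖) + E c)
    (hΛ : ∑ y : Site (F.P K) (K - n), ‖Λ y‖ ^ 2 ≤ cΛ * (F.L : ℝ) ^ (K - n) * G)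
    (hE : ∑ c : PBond (F.P K) (K - n), E c ^ 2 ≤ cE * ((F.L : ℝ) ^ (K - n)) ^ 5 * ε ^ 2 * ∑ b : PBond (F.P K) 0, ‖(W b : Matrix (Fin 2) (Fin 2) ℂ) * star (U₀ b : Matrix (Fin 2) (Fin 2) ℂ) - 1‖ ^ 2) :
    ((1 - 32 * cE * ε ^ 2) * (((F.L : ℝ) ^ (K - n)) ^ 2)⁻¹ - 18 * δ - 442368 * s ^ 2 - 13824 * (ε * (((F.L : ℝ) ^ (K - n)) ^ 2)⁻¹) ^ 2)
        * ∑ b : PBond (F.P K) 0, ‖(W b : Matrix (Fin 2) (Fin 2) ℂ) * star (U₀ b : Matrix (Fin 2) (Fin 2) ℂ) - 1‖ ^ 2 - 18 * Z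
      ≤ 72 * ∑ p : Plaq (F.P K) 0, ‖((GaugeField.plaqHol W p : Matrix.specialUnitaryGroup (Fin 2) ℂ) : Matrix (Fin 2) (Fin 2) ℂ) * star ((GaugeField.plaqHol U₀ p : Matrix.specialUnitaryGroup (Fin 2) ℂ) : Matrix (Fin 2) (Fin 2) ℂ) - 1‖ ^ 2
        + 384 * cΛ * G := by
  have hS2 := sum_normSq_le_curl_sq_of_divBudget_of_structure_T3 F n K U₀ hε hε1 hU₀
    (fun b => (W b : Matrix (Fin 2) (Fin 2) ℂ) * star (U₀ b : Matrix (Fin 2) (Fin 2) ℂ) - 1) hdivB Λ E hA hΛ hE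
  have hc := sum_hs_curl_le_relPlaq_T3 F n K W U₀ hU₀ hδ hs1
  have hS0 : 0 ≤ ∑ b : PBond (F.P K) 0, ‖(W b : Matrix (Fin 2) (Fin 2) ℂ) * star (U₀ b : Matrix (Fin 2) (Fin 2) ℂ) - 1‖ ^ 2 := Finset.sum_nonneg fun _ _ => sq_nonneg _
  nlinarith [hS2, hc, hS0]



end Summit.QuantumFields.YangMills.Theorems.Prop7RelPoincareDivBudget

end
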